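import Summits.ResolutionOfSingularities.ResolutionOfSingularities.Theorems.PurelyInseparableDim4PureLeafUnitOddThreeSteps
import HarnessLib
import HarnessLib.Audit.Tags

/-!
# Purely inseparable fourfolds — UNIFORM THEOREM (`a₀ = 3`): every unit leaf `x₀³·x₁^m·x₂^{2b}·x₃^{2c}·(1+x₀)` (`m` odd; any even dress) is an A-WIN of the plain game over `𝔽₂` ‖ K
# (cell res-dim4-pi; brick (δ) «unit leaves x^a(1+x_j)», UNIFORM family «a₀ = 3, one odd partner, even rest») [OURS · counted 0 · a theorem about OUR coordinate-centre frame v4, not about resolution]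

Width seat `res-dim4-p-10` (g5).  Sequel of `…PureLeafUnitOddPair` (`a₀ = 1`) and `…PureLeafUnitOddThreeSteps`.  A's rule for
`a₀ = 3`: the singleton `{x₀}` FIRST (`x₀³ → x₀`), then the `a₀ = 1` line.  B's only new option is to dress `x₁` at that first reply,
presenting the ORDER-1 shape `G̃_m·S² = (1+x₁)^{m−1}(x₀ + x₀x₁ + x₀²x₁)·S²` with an armed dress; A grinds the dress, every reply
re-presents `G̃_m` or un-dresses `x₁` back to the `a₀ = 1` leaf shape `x₀x₁^m(1+x₀)·S′²` (won by `stateWins_unitLeaf_oneOdd_dressed`),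
and with the `x`-part of the dress gone `G̃_m` has order `1` — no permissible centre.
* `stateWins_G` (strong induction on the dress weight), `stateWins_B` (one move), the leaf form **`stateWins_unitLeaf_threeOdd`**:
  for every `a` with `a₀ = 3`, `a₁` odd, `a₂, a₃` even and every booking, `StateWins 2 ⟨x^a·(1+x₀), r, exc⟩` over `𝔽₂`; and the
  partner-anywhere form `stateWins_unitLeaf_threeOdd_partner` (renaming, as in `…PureLeafUnitOddPairRename`).
Census instances (`a ∈ {1,2,3}⁴`): 3122 3212 3221 3223 3232 3322 (all already ‖ K by certificate); the theorem covers every size.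
NOT covered: `a₀ ≥ 5` (the liberal two-variable abstraction already fails: B dresses `x₁` while `x₀³` keeps the order; the real,
finite reservoir still loses — 5122, 5221 by certificate — but by a different mechanism).

Riders: `𝔽₂`-rational replies; the PLAIN coordinate game of OUR frame v4 (`StateWins 2`), not MODE 1h, not CJS; nothing here proves
F4-C(2,2), `Terminates1h 2 2` or resolution of singularities in dimension ≥ 4 / characteristic `p`; counted 0; AI kernel work, weaker
than expert review. bears_on: LADDER-RESOLUTION:D157-DOOR2 (res-dim4-pi · brick (δ) · unit-leaf row, uniform theorem).
Supports stmt-ResolutionOfSingularities-16155 (helper).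
-/

set_option linter.dupNamespace false

open MvPolynomial Finset

open scoped BigOperators

noncomputable section

namespace Summit.ResolutionOfSingularities.ResolutionOfSingularities.Theorems.PIDim4

namespace PureLeafNF

open Literature.AlgebraicGeometry.Resolution
open Literature.AlgebraicGeometry.Resolution.Hauser2010
open CentreBlowup PthPowerFactor

/-! ## 1. `G̃·S²` with an un-armed dress has no permissible centre -/

/-- The monomial `x₀` occurs in `G̃·S²` when the dress has no `x`-part. [folklore] -/
theorem coeff_X0_G (n e2 e3 : ℕ) : coeff (Finsupp.single 0 1) ((∏ l, X l ^ (![1, 0, 0, 0] : Fin 4 → ℕ) l * (1 + X l) ^ (![0, (n + 1), e2, e3] : Fin 4 → ℕ) l : MvPolynomial (Fin 4) (ZMod 2)) + (∏ l, X l ^ (![2, 1, 0, 0] : Fin 4 → ℕ) l * (1 + X l) ^ (![0, n, e2, e3] : Fin 4 → ℕ) l : MvPolynomial (Fin 4) (ZMod 2))) = 1 := by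
  have hs : (Finsupp.single (0 : Fin 4) 1 : Fin 4 →₀ ℕ) = Finsupp.equivFunOnFinite.symm (![1, 0, 0, 0] : Fin 4 → ℕ) := by
    ext l; fin_cases l <;> simp
  rw [coeff_add, hs, coeff_self_prod]
  rw [MvPolynomial.notMem_support_iff.mp, add_zero]
  intro hmem
  have hle := le_of_mem_support_prod (![2, 1, 0, 0] : Fin 4 → ℕ) (![0, n, e2, e3] : Fin 4 → ℕ) hmem
  have h1 := hle 1
  simp at h1

/-! ## 2. The theorems -/

/-- **`G̃·S²` wins** for every odd `m = n+1`, every even dress, every booking: A grinds the dress; B either keeps `G̃` (weight drops)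
or un-dresses `x₁` into the `a₀ = 1` leaf shape (won by `…PureLeafUnitOddPair`); an un-armed dress leaves order `1`. [OURS · counted 0]
[folklore] -/
theorem stateWins_G : ∀ W : ℕ, ∀ n g2 g3 e2 e3 : ℕ, n % 2 = 0 → g2 % 2 = 0 → g3 % 2 = 0 → e2 % 2 = 0 → e3 % 2 = 0 →
    g2 + g3 + e2 + e3 ≤ W → ∀ (r : Fin 4 →₀ ℕ) (exc : Finset (Fin 4)),
      StateWins 2 (⟨((∏ l, X l ^ (![1, 0, g2, g3] : Fin 4 → ℕ) l * (1 + X l) ^ (![0, (n + 1), e2, e3] : Fin 4 → ℕ) l : MvPolynomial (Fin 4) (ZMod 2)) + (∏ l, X l ^ (![2, 1, g2, g3] : Fin 4 → ℕ) l * (1 + X l) ^ (![0, n, e2, e3] : Fin 4 → ℕ) l : MvPolynomial (Fin 4) (ZMod 2))), r, exc⟩ : State (ZMod 2)) := by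
  intro W
  induction W using Nat.strong_induction_on with
  | _ W IH =>
  intro n g2 g3 e2 e3 hn hg2 hg3 he2 he3 hle r exc
  have hstate : ∀ t : State (ZMod 2), t = ⟨t.F, t.r, t.exc⟩ := fun t => rfl
  by_cases hzero : g2 = 0 ∧ g3 = 0
  · obtain ⟨rfl, rfl⟩ := hzero
    exact Game.Wins.terminal fun T hT => not_isPermissibleCentre_of_coeff_X0 _ (coeff_X0_G n e2 e3) T hT
  by_cases h2 : g2 = 0
  · have hg3i : 2 ≤ g3 := by omega
    unfold StateWins
    refine Game.Wins.move (m := ({3} : Finset (Fin 4))) ⟨Finset.singleton_nonempty 3, ?_⟩ ?_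
    · exact two_le_ordAlong_add 3 _ _ _ _ (by simpa using hg3i) (by simpa using hg3i)
    rintro s' ⟨j', b, hj', hbj, -, -, rfl⟩
    rw [Finset.mem_singleton] at hj'
    subst hj'
    rw [hstate (step 2 _ _ b _)]
    rcases step_F_grind3_G n g2 g3 e2 e3 hn hg2 hg3 he2 he3 hg3i b hbj r exc with ⟨hF, -⟩ | ⟨hF, -⟩
    · rw [hF]
      exact IH (g2 + g3 + e2 + e3 - 2) (by omega) n _ _ _ _ hn (by split_ifs <;> assumption) (by omega)
        (by split_ifs <;> assumption) he3 (by split_ifs <;> omega) _ _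
    · rw [hF]
      exact stateWins_unitLeaf_oneOdd_dressed (n + 1) _ _ _ _ (by omega) (by split_ifs <;> assumption) (by omega)
        (by split_ifs <;> assumption) he3 _ _
  · have hg2i : 2 ≤ g2 := by omega
    unfold StateWins
    refine Game.Wins.move (m := ({2} : Finset (Fin 4))) ⟨Finset.singleton_nonempty 2, ?_⟩ ?_
    · exact two_le_ordAlong_add 2 _ _ _ _ (by simpa using hg2i) (by simpa using hg2i)
    rintro s' ⟨j', b, hj', hbj, -, -, rfl⟩
    rw [Finset.mem_singleton] at hj'
    subst hj'
    rw [hstate (step 2 _ _ b _)]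
    rcases step_F_grind2_G n g2 g3 e2 e3 hn hg2 hg3 he2 he3 hg2i b hbj r exc with ⟨hF, -⟩ | ⟨hF, -⟩
    · rw [hF]
      exact IH (g2 + g3 + e2 + e3 - 2) (by omega) n _ _ _ _ hn (by omega) (by split_ifs <;> assumption) he2
        (by split_ifs <;> assumption) (by split_ifs <;> omega) _ _
    · rw [hF]
      exact stateWins_unitLeaf_oneOdd_dressed (n + 1) _ _ _ _ (by omega) (by omega) (by split_ifs <;> assumption) he2
        (by split_ifs <;> assumption) _ _

/-- **`B·S² = x₀³x₁^{n+1}(1+x₀)·S²` wins** (`n` even, every even dress, every booking): the singleton `{x₀}`. [OURS · counted 0] [folklore] -/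
theorem stateWins_B (n g2 g3 e2 e3 : ℕ) (hn : n % 2 = 0) (hg2 : g2 % 2 = 0) (hg3 : g3 % 2 = 0) (he2 : e2 % 2 = 0)
    (he3 : e3 % 2 = 0) (r : Fin 4 →₀ ℕ) (exc : Finset (Fin 4)) :
    StateWins 2 (⟨(∏ l, X l ^ (![3, (n + 1), g2, g3] : Fin 4 → ℕ) l * (1 + X l) ^ (![1, 0, e2, e3] : Fin 4 → ℕ) l : MvPolynomial (Fin 4) (ZMod 2)), r, exc⟩ : State (ZMod 2)) := by
  have hstate : ∀ t : State (ZMod 2), t = ⟨t.F, t.r, t.exc⟩ := fun t => rfl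
  have hP : ∀ u : ℕ, u % 2 = 0 → ∀ v : ℕ, v % 2 = 0 → ∀ z : ZMod 2, (if z = 0 then u else v) % 2 = 0 := by
    intro u hu v hv z; split_ifs <;> assumption
  unfold StateWins
  refine Game.Wins.move (m := ({0} : Finset (Fin 4))) ⟨Finset.singleton_nonempty 0, ?_⟩ ?_
  · show (2 : ℕ∞) ≤ ordAlong {0} (∏ l, X l ^ (![3, (n + 1), g2, g3] : Fin 4 → ℕ) l * (1 + X l) ^ (![1, 0, e2, e3] : Fin 4 → ℕ) l : MvPolynomial (Fin 4) (ZMod 2))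
    rw [ordAlong_prod, degIn_singleton]
    simpa using (show (2 : ℕ∞) ≤ (3 : ℕ∞) by exact_mod_cast (by omega : 2 ≤ 3))
  rintro s' ⟨j', b, hj', hbj, -, -, rfl⟩
  rw [Finset.mem_singleton] at hj'
  subst hj'
  rw [hstate (step 2 _ _ b _)]
  rcases step_F_grind0_B n g2 g3 e2 e3 hn hg2 hg3 he2 he3 b hbj r exc with ⟨hF, -⟩ | ⟨hF, -⟩
  · rw [hF]
    exact stateWins_unitLeaf_oneOdd_dressed (n + 1) _ _ _ _ (by omega) (hP _ hg2 _ he2 _) (hP _ hg3 _ he3 _)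
      (hP _ he2 _ hg2 _) (hP _ he3 _ hg3 _) _ _
  · rw [hF]
    exact stateWins_G _ n _ _ _ _ hn (hP _ hg2 _ he2 _) (hP _ hg3 _ he3 _) (hP _ he2 _ hg2 _) (hP _ he3 _ hg3 _) le_rfl _ _

/-- **UNIFORM THEOREM (unit leaves, `a₀ = 3`, partner `x₁`).** For every `a` with `a₀ = 3`, `a₁` odd and `a₂, a₃` even, and every
booking, the unit leaf `x^a·(1+x₀)` is an A-WIN of the plain game over `𝔽₂`. [OURS · counted 0 · ‖ K] [folklore] -/
theorem stateWins_unitLeaf_threeOdd (a : Fin 4 → ℕ) (h0 : a 0 = 3) (h1 : a 1 % 2 = 1) (h2 : a 2 % 2 = 0) (h3 : a 3 % 2 = 0)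
    (r : Fin 4 →₀ ℕ) (exc : Finset (Fin 4)) :
    StateWins 2 (⟨monomial (Finsupp.equivFunOnFinite.symm a) 1 * (1 + X 0), r, exc⟩ : State (ZMod 2)) := by
  have ha : a = (![3, (a 1 - 1 + 1), a 2, a 3] : Fin 4 → ℕ) := by
    funext l
    fin_cases l
    · simp [h0]
    · simp; omega
    · simp
    · simp
  have hF : (monomial (Finsupp.equivFunOnFinite.symm a) 1 * (1 + X 0) : MvPolynomial (Fin 4) (ZMod 2)) =
      (∏ l, X l ^ (![3, ((a 1 - 1) + 1), (a 2), (a 3)] : Fin 4 → ℕ) l * (1 + X l) ^ (![1, 0, 0, 0] : Fin 4 → ℕ) l : MvPolynomial (Fin 4) (ZMod 2)) := by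
    rw [prod_eq_monomial_mul, Fin.prod_univ_four, ha]
    simp
  rw [hF]
  exact stateWins_B (a 1 - 1) (a 2) (a 3) 0 0 (by omega) h2 h3 (by decide) (by decide) r exc

/-- … with the odd partner ANYWHERE (`k ≠ 0`, `a₀ = 3`, `a_k` odd, the other two even). [OURS · counted 0 · ‖ K] [folklore] -/
theorem stateWins_unitLeaf_threeOdd_partner (k : Fin 4) (hk : k ≠ 0) (a : Fin 4 → ℕ) (h0 : a 0 = 3) (hk1 : a k % 2 = 1)
    (hev : ∀ i, i ≠ 0 → i ≠ k → a i % 2 = 0) (r : Fin 4 →₀ ℕ) (exc : Finset (Fin 4)) :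
    StateWins 2 (⟨monomial (Finsupp.equivFunOnFinite.symm a) 1 * (1 + X 0), r, exc⟩ : State (ZMod 2)) := by
  -- transport along a renaming fixing `x₀`, as in `…PureLeafUnitOddPairRename`
  have key : ∀ (e : Equiv.Perm (Fin 4)), e 0 = 0 → a (e 1) % 2 = 1 → a (e 2) % 2 = 0 → a (e 3) % 2 = 0 →
      StateWins 2 (⟨monomial (Finsupp.equivFunOnFinite.symm a) 1 * (1 + X 0), r, exc⟩ : State (ZMod 2)) := by
    intro e he0 he1 he2 he3
    have h' := stateWins_unitLeaf_threeOdd (fun i => a (e i)) (by simp [he0, h0]) he1 he2 he3 r exc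
    have hren := WinCertF.stateWins_rebook (PureLeafGlobalWin.stateWins_rename e 2 h') r exc
    have hd : Finsupp.mapDomain (⇑e) (Finsupp.equivFunOnFinite.symm fun i => a (e i)) = Finsupp.equivFunOnFinite.symm a := by
      ext i
      rw [Finsupp.mapDomain_equiv_apply]
      simp
    have hF : (State.rename e (⟨monomial (Finsupp.equivFunOnFinite.symm fun i => a (e i)) 1 * (1 + X 0), r, exc⟩ :
        State (ZMod 2))).F = monomial (Finsupp.equivFunOnFinite.symm a) 1 * (1 + X 0) := by
      show rename e (monomial (Finsupp.equivFunOnFinite.symm fun i => a (e i)) 1 * (1 + X 0) : MvPolynomial (Fin 4) (ZMod 2)) = _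
      rw [map_mul, rename_monomial, hd, map_add, map_one (rename (⇑e)), rename_X, he0]
    rw [hF] at hren
    exact hren
  fin_cases k
  · exact absurd rfl hk
  · exact key (Equiv.refl _) rfl hk1 (hev 2 (by decide) (by decide)) (hev 3 (by decide) (by decide))
  · exact key (Equiv.swap 1 2) (by decide) (by simpa using hk1) (by simpa using hev 1 (by decide) (by decide))
      (by simpa [Equiv.swap_apply_of_ne_of_ne] using hev 3 (by decide) (by decide))
  · exact key (Equiv.swap 1 3) (by decide) (by simpa using hk1)
      (by simpa [Equiv.swap_apply_of_ne_of_ne] using hev 2 (by decide) (by decide)) (by simpa using hev 1 (by decide) (by decide))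

end PureLeafNF

end Summit.ResolutionOfSingularities.ResolutionOfSingularities.Theorems.PIDim4

end
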